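import Literature.NumberTheory.EllipticCurves.Kato2004.IwasawaH2FineSelmerDualComparison
import Literature.NumberTheory.EllipticCurves.IwasawaEulerCharDualityProofs
import HarnessLib

/-!
# Kato 2004 (Astérisque 295): `𝐇²_Γ(T_pW) ⊇ X₀(E/ℚ_∞)` with cokernel EMBEDDED INTO `(W(ℚ_{p,∞})[p^∞])^∨`
# (Poitou–Tate in the limit: (14.9.1) → (17.13.1) «`𝒳 → 𝐇²(T) → 𝐇²_loc(T)`», `𝐇²_loc ≅ Hom(H⁰(ℚ_p(ζ_{p^∞}),
# Hom(T, ℚ/ℤ)), ℚ/ℤ)(−1)` after (12.2.3)) — ONE named fact, the SEQUEL "H2X′" of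
# `exists_iwasawaH2Data_fineSelmerDual_embedding` (H2X), and its proved corollaries (H2X′ → H2X; H2X′ ∧
# `W(ℚ_{p,∞})[p^∞] = 0` → the embedding is BIJECTIVE)

Topic `NumberTheory/EllipticCurves`, sub-directory `Kato2004` (namespace = path). ONE `def … : Prop` (named fact,
review-queued, net debt +1), theorems otherwise; no instance, no notation, no `sorry`. Seat `bsd-cm-prr-ty1` (generation 16,
literature-prover, cell `bsd-cm`; cruxes stmt-BirchSwinnertonDyer-19945 / -19223, stub 3 of the Kato–Perrin-Riou skeletons),
minted under the cell planner's typing guidance D455 (pub/bsd-cm STATUS 2026-08-28T19:06:59Z / pub/bsd-potss INBOX 19:06:48Z: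
(α) Literature is append-only ⇒ a sequel named fact in a NEW module importing H2X's file, with PROVED corollaries H2X′ → H2X and
H2X′ → `W(ℚ_{p,∞})[p^∞] = 0` → `e` bijective; (γ) kind definition, review lane, debt +1; (δ) a prr-ty1 seat that frees before
cell bsd-potss's typer announces may take it — no such announce on pub/bsd-potss/STATUS to 2026-08-29T12:00Z) and the planner's
SOURCE CHECK of this exact text D554 (2026-08-29T02:58:03Z, requirements R-N1/R-N2 below).  The TEXT of the fact is the display
`hH2X'` of the tree theorems `Summit…Rank1Residual.Additive.StrictCount.h2x_conclusion_of_h2x'`, `….exists_bijective_of_h2x'`,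
`….countX₀_tame_of_gzk_of_thm12_4_of_h2x'`, `….rankOneCountReading_tame_of_facts` (`Summits/BirchSwinnertonDyer/Rank1Residual/
Additive/KatoDescentRankOneCountTame.lean`, p691851) VERBATIM, so those theorems are fed by this fact BY NAME.  HONEST FRAMING:
BSD is not advanced by this file; nothing about Kato's Main Conjecture is asserted; the fact is a CONSTRUCTION fact about Kato's
genuine `𝐇²_Γ(T_pW)` (as H2X, H2X⁺ `IwasawaH2FineSelmerDualCount.lean` and `nonempty_iwasawaH2Data` are), never stronger than
print (below, SCOPE).

## Why a sequel (what the extra clause is for)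

H2X (`IwasawaH2FineSelmerDualComparison.lean`, p624791; its module docstring transcribes the printed mechanism with page and
line references, not repeated here) keeps, of Kato's exact sequence of `Λ`-modules on the `Δ`-trivial component

  `0 → X₀(E/ℚ_∞) → 𝐇²_Γ(T_pW) → 𝐇²_{Γ,loc}(T_pW) ≅ (W(ℚ_{p,∞})[p^∞])^∨`

((14.9.1) p. 239 "exact in the case `p ≠ 2`", passed to `lim←_n` over `ℚ(ζ_{p^n})` as in (17.13.1) p. 279 — all terms
compact —, the local term read through "`𝐇²_loc(T) ≅ Hom(H⁰(ℚ_p(ζ_{p^∞}), Hom(T, ℚ/ℤ)), ℚ/ℤ)(−1)`", the display after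
(12.2.3) p. 220, `Hom(T_pW, ℚ/ℤ)(−1)… = W[p^∞]` by the Weil pairing, `e₀` of it `= (W(ℚ_{p,∞})[p^∞])^∨` with `ℚ_{p,∞}` the
cyclotomic `ℤ_p`-extension of `ℚ_p`), ONLY the consequence "`X₀ ↪ 𝐇²_Γ` with FINITE cokernel", and only under the hypothesis
"`W(ℚ_{p,∞})[p^∞]` finite".  The SAME printed sequence says more, and two consumers need the more:
* the cokernel of `X₀ → 𝐇²_Γ` EMBEDS (additively) INTO the Pontryagin dual of `W(ℚ_{p,∞})[p^∞]` — so that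
  (i) when `W(ℚ_{p,∞})[p^∞]` is finite the cokernel is finite (H2X's conclusion: corollary `embedding` below), and
  (ii) when `W(ℚ_{p,∞})[p^∞] = 0` — every row with `W(ℚ_p)[p] = 0` by the tree theorem
  `Summit…TowerTorsionVanishing.fixedPoints_kerSubgroup_inf_decomp_eq_bot_of_noPTorsionPadic` (p657752; 𝒞₇ at `7`, the
  signed types `(p, I₀*)` at `p ≥ 5`, every additive `p ≥ 11`, cell bsd-potss's (t′) rows) — the embedding is BIJECTIVE:
  Kato's `𝐇²_Γ(T_pW)` IS `X₀(E/ℚ_∞)` on the nose (corollary `exists_bijective_of_eq_bot`).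
  Consumer (ii) is cell bsd-cm's «COUNT-X₀ on the tame rows» (p691851 §2: with exact fine control, `KatoH2CountAt W p #((X₀)_γ)_Γ`)
  and cell bsd-potss's T-M-TAME re-typing of the reducible-member node stmt-BirchSwinnertonDyer-19196 over pinned objects
  (pub/bsd-potss TARGET R294); consumer (i) keeps every H2X consumer served (`embedding`).
No finiteness hypothesis is needed to STATE the embedding, and none is printed for (14.9.1)/(17.13.1): the finiteness of
`𝐇²_loc` ((17.13.4), "by the latter half of Thm. 12.5 (3)") is a separate statement used afterwards (p. 280).

## SCOPE of the fact (planner D554 R-N1/R-N2; exactly the printed hypotheses; where it says nothing)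

* `p ≠ 2` (R-N2: Kato's (14.9.1)/(17.13.1) are "exact upto `×2`" at `p = 2`; without the guard the statement would assert more
  than print).
* `κ` CYCLOTOMIC with topological generator `γ` (the tower of (12.2)/(14.14.1); `Λ = ℤ_p⟦T⟧`, `T = γ − 1`); `W/ℚ` elliptic; every
  pin `I : IwasawaH1Data W p κ γ` (as in H2X).
* (R-N1) the target of `c` is typed EXACTLY as the Pontryagin dual (Mathlib `CharacterModule`, `Hom(·, ℚ/ℤ)`) of the fixed
  points `W(ℚ̄)[p^∞]^{ker κ ⊓ D_v}` (`ZpExtension.kerSubgroup`, `GreenbergSelmer.decomp v`, `v` the place of `ℚ` above `p`,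
  `W.geomPrimaryTorsion p`) `= W(ℚ_{p,∞})[p^∞]` `= e₀·𝐇²_loc(T_pW)` (twist) via p. 220 + the Weil pairing
  [corpus: paper:doi-10-24033-ast-639 p105 L37–55 (= p. 220), p124 L70–100 (= p. 239), p164 L18–75 (= p. 279)].  `c` is only
  asserted ADDITIVE and INJECTIVE: the `Λ`-linearity of `𝐇² → 𝐇²_loc`, the Tate twist and the `Gal(ℚ_{p,∞}/ℚ_p)`-action on the
  target are forgotten — WEAKER than print, never stronger.
* NO hypothesis on `W(ℚ_{p,∞})[p^∞]`: where it is infinite (for `p` odd exactly Kato's (12.5.1), `p = 3` and `W/ℚ_3` the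
  `ω`-twist of a Tate curve, Rem. 12.7 p. 222) the fact still asserts only the printed exact sequence (there `𝐇²` exceeds `X₀`
  by a module of positive length, consistent with an injective `c` into an infinite dual); nothing is said at `p = 2` or for
  non-cyclotomic `κ`.
STRONGER than H2X (corollary `embedding`: H2X′ ⟹ H2X), hence its junk audit is inherited: not vacuous (it produces a package
with (14.14.1) AND pins `J.H2` to the CONSTRUCTED `X₀ = (W.fineSelmerDualData κ hγ).X` up to a sub-quotient of
`(W(ℚ_{p,∞})[p^∞])^∨`; the manufactured package of `IwasawaH2DataOfInjectivityProofs` (`H2` killed by `T`) does not in general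
satisfy it, and on a row with `W(ℚ_{p,∞})[p^∞] = 0` a `J` padded by any non-zero finite module satisfies H2X but NOT H2X′);
not refutable by cooked data (an `∃`).  PRESEARCH (this seat): primary source held and re-read at the three loci above;
secondary prints of the same Poitou–Tate mechanism (context only, not the statement): Kurihara, Invent. Math. 149 (2002) §1;
Kobayashi, Invent. Math. 152 (2003) §7; Coates–Sujatha, Math. Ann. 331 (2005) Lemma 3.1; Perrin-Riou, Astérisque 229 (1995)
§1.3 / App. B; `lit search --hybrid` / `lit vsearch` / `lit galaxy search "fine Selmer|H^2_{Iw}|Poitou-Tate sequence"` return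
no held page stating the cyclotomic-limit sequence with Kato's `j_*`-convention beyond the primary source.

## References

* K. Kato, Astérisque 295 (2004): 8.2 (p. 180), 12.2 (12.2.1)–(12.2.3) and the display after it (p. 220), Thm. 12.4 (1)
  (p. 221), Thm. 12.5 (3) with (12.5.1) and Rem. 12.7 (p. 222), 13.8 (p. 228), (14.9.1) (p. 239), (14.14.1) (p. 243),
  (17.13.1)–(17.13.4) (pp. 279–280) — store key `paper:doi-10-24033-ast-639`, PDF pp. 105, 124–125, 164–165 re-read by this
  seat. [Kato2004Asterisque]
* J.-P. Serre, *Galois Cohomology* (1997), II §5.2 (local Tate duality, Kato's [Se1]). [SerreGaloisCohomology1997]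
* J. S. Milne, *Arithmetic Duality Theorems* (2006), I Cor. 2.3. [MilneADT2006]
* R. Greenberg, LNM 1716 (1999) §3 Lemma 3.1 (the vanishing `E(ℚ_{p,∞})[p^∞] = 0` ⇐ `E(ℚ_p)[p] = 0`, pro-`p` group). [GreenbergLNM1716]
* H. Imai, Proc. Japan Acad. 51 (1975) 12–16, Theorem (p. 12). [Imai1975] (scope remark only)
* Tree: `Kato2004/IwasawaH2FineSelmerDualComparison.lean` (H2X, the fact this file sharpens), `Kato2004/IwasawaH2FineSelmerDualCount.lean`
  (H2X⁺, the other sequel, cell bsd-potss), `Kato2004/IwasawaH2Descent.lean` (`IwasawaH2Data`), `KatoFineSelmerDualProofs.lean`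
  (`WeierstrassCurve.fineSelmerDualData`), `GreenbergSelmer.lean` (`decomp`), `IwasawaEulerCharDualityProofs.lean`
  (`PontryaginCard.finite_characterModule_of_finite`); consumers `Summits/…/Rank1Residual/Additive/KatoDescentRankOneCountTame.lean`
  (display `hH2X'` = this text), `Summits/…/Theorems/KatoDescentPotSupersingularTowerTorsionVanishing.lean`.
-/

noncomputable section

open scoped NumberField
open Field IsDedekindDomain
open Literature.NumberTheory.GaloisRepresentations
open Literature.NumberTheory.EllipticCurves Literature.NumberTheory.EllipticCurves.IwasawaAlgebra
open Literature.NumberTheory.EllipticCurves.Module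

namespace Literature.NumberTheory.EllipticCurves.Kato2004

/-! ## Algebra: a cokernel embedded in a trivial / finite group -/

section Algebra

variable {p : ℕ} [Fact p.Prime] {M N : Type*} [AddCommGroup M] [_root_.Module (IwasawaAlgebra p) M]
  [AddCommGroup N] [_root_.Module (IwasawaAlgebra p) N]

/-- The character module of a trivial group is trivial. [folklore] -/
private theorem subsingleton_characterModule_of_subsingleton' (A : Type*) [AddCommGroup A] [Subsingleton A] :
    Subsingleton (CharacterModule A) :=
  ⟨fun f g ↦ by ext a; rw [Subsingleton.elim a 0, map_zero, map_zero]⟩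

/-- A linear map whose cokernel embeds into a trivial group is surjective. [folklore] -/
private theorem surjective_of_injective_quotient_of_subsingleton' (e : M →ₗ[IwasawaAlgebra p] N) {C : Type*}
    [AddCommGroup C] [Subsingleton C] (c : (N ⧸ LinearMap.range e) →+ C) (hc : Function.Injective c) :
    Function.Surjective e := by
  rw [← LinearMap.range_eq_top, ← Submodule.Quotient.subsingleton_iff]
  exact ⟨fun x y ↦ hc (Subsingleton.elim _ _)⟩

end Algebra

/-! ## The named fact -/

/-- **Kato's `𝐇²_Γ(T_pW)` contains the dual fine Selmer group `X₀(E/ℚ_∞)` with cokernel embedded into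
`(W(ℚ_{p,∞})[p^∞])^∨` (`p` odd).**  For an elliptic curve `W/ℚ`, an odd prime `p`, the CYCLOTOMIC `ℤ_p`-extension `κ` with
topological generator `γ`, the place `v` of `ℚ` at `p`, and every pinned Iwasawa cohomology `I : IwasawaH1Data W p κ γ`
(`𝐇¹_Γ(T_pW)`): there is a descent package `J : IwasawaH2Data W p κ γ I` (Kato's `𝐇²_Γ(T_pW)`: finitely generated (12.2.1),
torsion (Thm. 12.4 (1)), with `H¹(ℤ[1/p], T_pW)` and the exact sequence (14.14.1) pinned to `proj₀`) TOGETHER WITH an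
injective `Λ`-linear map `e` from the constructed dual fine Selmer group `X₀(E/ℚ_∞) = (W.fineSelmerDualData κ hγ).X` into
`J.H2` AND an injective additive map `c` from the cokernel `J.H2 ⧸ range e` into the Pontryagin dual
`Hom(W(ℚ̄)[p^∞]^{ker κ ⊓ D_v}, ℚ/ℤ)` of `W(ℚ_{p,∞})[p^∞]` — the limit over the layers `ℚ_n` of Kato's Poitou–Tate sequence
(14.9.1) ("exact in the case `p ≠ 2`"), `0 → 𝒳 → 𝐇²(T) → 𝐇²_loc(T)` as in (17.13.1), read on the `Δ`-trivial component through
`𝐇²_loc(T) ≅ Hom(H⁰(ℚ_p(ζ_{p^∞}), Hom(T, ℚ/ℤ)), ℚ/ℤ)(−1)` (display after (12.2.3)) and the Weil pairing.  The text is VERBATIM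
the display `hH2X'` of `Summit…StrictCount.rankOneCountReading_tame_of_facts` (p691851).  A CONSTRUCTION fact
(review-queued); SCOPE and conventions: module docstring — `c` is only asserted additive and injective (weaker than print);
no hypothesis on `W(ℚ_{p,∞})[p^∞]`; nothing is asserted at `p = 2` or for non-cyclotomic `κ`.  STRONGER than
`exists_iwasawaH2Data_fineSelmerDual_embedding` (corollary `embedding`).
[cite: Kato2004Asterisque, (14.9.1) (p. 239), (17.13.1) (p. 279), 12.2 (12.2.1)–(12.2.3) and the display after it (p. 220), Thm. 12.4 (1) (p. 221), 13.8 (p. 228), (14.14.1) (p. 243)]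
[cite: SerreGaloisCohomology1997, II §5.2] -/
def exists_iwasawaH2Data_fineSelmerDual_embedding_loc : Prop :=
  ∀ (W : WeierstrassCurve ℚ) [W.IsElliptic] (p : ℕ) [Fact p.Prime] [ContinuousSMul ℤ_[p] (W.tateModule p)]
    (κ : ZpExtension ℚ p) (γ : absoluteGaloisGroup ℚ) (hγ : κ.IsTopGenerator γ) (v : HeightOneSpectrum (𝓞 ℚ)),
    p ≠ 2 → κ.IsCyclotomic → ((Rat.HeightOneSpectrum.primesEquiv v : Nat.Primes) : ℕ) = p →
    ∀ I : IwasawaH1Data W p κ γ,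
      ∃ (J : IwasawaH2Data W p κ γ I) (e : (W.fineSelmerDualData κ hγ).X →ₗ[IwasawaAlgebra p] J.H2)
        (c : (J.H2 ⧸ LinearMap.range e) →+
          CharacterModule ↥(FixedPoints.addSubgroup ↥(κ.kerSubgroup ⊓ GreenbergSelmer.decomp v) (W.geomPrimaryTorsion p))),
        Function.Injective e ∧ Function.Injective c

/-! ## Proved corollaries (the consumer shapes) -/

section Corollaries

/-- **H2X′ ⟹ H2X**: under the fact, H2X's conclusion holds under H2X's hypothesis («`W(ℚ_{p,∞})[p^∞]` finite»): the character
module of a finite group is finite (`PontryaginCard.finite_characterModule_of_finite`), so a cokernel embedded in it is finite.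
[cite: Kato2004Asterisque, (14.9.1) (p. 239), (17.13.1) (p. 279)] [cite: MilneADT2006, Ch. I, Cor. 2.3] -/
theorem exists_iwasawaH2Data_fineSelmerDual_embedding_loc.embedding
    (h : exists_iwasawaH2Data_fineSelmerDual_embedding_loc) : exists_iwasawaH2Data_fineSelmerDual_embedding := by
  intro W _ p _ _ κ γ hγ v hp hκ hv hfin I
  obtain ⟨J, e, c, he, hc⟩ := h W p κ γ hγ v hp hκ hv I
  haveI := hfin
  haveI := PontryaginCard.finite_characterModule_of_finite
    (↥(FixedPoints.addSubgroup ↥(κ.kerSubgroup ⊓ GreenbergSelmer.decomp v) (W.geomPrimaryTorsion p)))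
  exact ⟨J, e, he, Finite.of_injective c hc⟩

variable {W : WeierstrassCurve ℚ} [W.IsElliptic] {p : ℕ} [Fact p.Prime] [ContinuousSMul ℤ_[p] (W.tateModule p)]
  {κ : ZpExtension ℚ p} {γ : absoluteGaloisGroup ℚ}

/-- **H2X′ ∧ `W(ℚ_{p,∞})[p^∞] = 0` ⟹ Kato's `𝐇²`-package IS `X₀(E/ℚ_∞)`**: over every pin there is a package `J` with a
BIJECTIVE `Λ`-linear `e : (W.fineSelmerDualData κ hγ).X → J.H2` (the cokernel embeds into the character module of the trivial
group).  The vanishing holds whenever `W(ℚ_p)[p] = 0` (pro-`p` group acting on a `p`-group; tree theorem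
`Summit…TowerTorsionVanishing.fixedPoints_kerSubgroup_inf_decomp_eq_bot_of_noPTorsionPadic`, not imported here).
[cite: Kato2004Asterisque, (14.9.1) (p. 239), (17.13.1)–(17.13.4) (pp. 279–280)] [cite: GreenbergLNM1716, §3 Lemma 3.1] -/
theorem exists_iwasawaH2Data_fineSelmerDual_embedding_loc.exists_bijective_of_eq_bot
    (h : exists_iwasawaH2Data_fineSelmerDual_embedding_loc) (hγ : κ.IsTopGenerator γ) (v : HeightOneSpectrum (𝓞 ℚ))
    (hp : p ≠ 2) (hκ : κ.IsCyclotomic) (hv : ((Rat.HeightOneSpectrum.primesEquiv v : Nat.Primes) : ℕ) = p)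
    (hbot : FixedPoints.addSubgroup ↥(κ.kerSubgroup ⊓ GreenbergSelmer.decomp v) (W.geomPrimaryTorsion p) = ⊥)
    (I : IwasawaH1Data W p κ γ) :
    ∃ (J : IwasawaH2Data W p κ γ I) (e : (W.fineSelmerDualData κ hγ).X →ₗ[IwasawaAlgebra p] J.H2),
      Function.Bijective e := by
  obtain ⟨J, e, c, he, hc⟩ := h W p κ γ hγ v hp hκ hv I
  haveI : Subsingleton ↥(FixedPoints.addSubgroup ↥(κ.kerSubgroup ⊓ GreenbergSelmer.decomp v) (W.geomPrimaryTorsion p)) := by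
    rw [hbot]; infer_instance
  haveI := subsingleton_characterModule_of_subsingleton'
    (↥(FixedPoints.addSubgroup ↥(κ.kerSubgroup ⊓ GreenbergSelmer.decomp v) (W.geomPrimaryTorsion p)))
  exact ⟨J, e, he, surjective_of_injective_quotient_of_subsingleton' e c hc⟩

/-- … packaged as a `Λ`-linear ISOMORPHISM `X₀(E/ℚ_∞) ≃ₗ J.H2` for some package `J` over the pin.
[cite: Kato2004Asterisque, (14.9.1) (p. 239), (17.13.1)–(17.13.4) (pp. 279–280)] -/
theorem exists_iwasawaH2Data_fineSelmerDual_embedding_loc.exists_linearEquiv_of_eq_bot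
    (h : exists_iwasawaH2Data_fineSelmerDual_embedding_loc) (hγ : κ.IsTopGenerator γ) (v : HeightOneSpectrum (𝓞 ℚ))
    (hp : p ≠ 2) (hκ : κ.IsCyclotomic) (hv : ((Rat.HeightOneSpectrum.primesEquiv v : Nat.Primes) : ℕ) = p)
    (hbot : FixedPoints.addSubgroup ↥(κ.kerSubgroup ⊓ GreenbergSelmer.decomp v) (W.geomPrimaryTorsion p) = ⊥)
    (I : IwasawaH1Data W p κ γ) :
    ∃ J : IwasawaH2Data W p κ γ I, Nonempty ((W.fineSelmerDualData κ hγ).X ≃ₗ[IwasawaAlgebra p] J.H2) := by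
  obtain ⟨J, e, he⟩ := h.exists_bijective_of_eq_bot hγ v hp hκ hv hbot I
  exact ⟨J, ⟨LinearEquiv.ofBijective e he⟩⟩

/-- **The (H2)-lengths clause from H2X′** (through `embedding` and H2X's `lengthAt_eq`): for `p` odd, `κ` cyclotomic,
`W(ℚ_{p,∞})[p^∞]` finite and any pin `I`, some package `J` has `length_{Λ_𝔮}(J.H2)_𝔮 = length_{Λ_𝔮} X₀(E/ℚ_∞)_𝔮` at every
height-one prime `𝔮`. [cite: Kato2004Asterisque, (14.9.1) (p. 239), Thm. 12.4 (1) (p. 221), (14.14.1) (p. 243)] -/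
theorem exists_iwasawaH2Data_fineSelmerDual_embedding_loc.lengthAt_eq
    (h : exists_iwasawaH2Data_fineSelmerDual_embedding_loc) (hγ : κ.IsTopGenerator γ)
    (v : HeightOneSpectrum (𝓞 ℚ)) (hp : p ≠ 2) (hκ : κ.IsCyclotomic)
    (hv : ((Rat.HeightOneSpectrum.primesEquiv v : Nat.Primes) : ℕ) = p)
    (hfin : Finite (FixedPoints.addSubgroup ↥(κ.kerSubgroup ⊓ GreenbergSelmer.decomp v)
      (W.geomPrimaryTorsion p)))
    (I : IwasawaH1Data W p κ γ) :
    ∃ J : IwasawaH2Data W p κ γ I, ∀ 𝔮 : PrimeSpectrum (IwasawaAlgebra p), 𝔮.asIdeal.height = 1 →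
      lengthAt (IwasawaAlgebra p) J.H2 𝔮 = lengthAt (IwasawaAlgebra p) (W.fineSelmerDualData κ hγ).X 𝔮 :=
  h.embedding.lengthAt_eq hγ v hp hκ hv hfin I

/-- **On a row with `W(ℚ_{p,∞})[p^∞] = 0` the lengths agree at EVERY prime of `Λ`** (any height), since `J.H2 ≅ X₀`.
[cite: Kato2004Asterisque, (14.9.1) (p. 239), (17.13.1)–(17.13.4) (pp. 279–280)] -/
theorem exists_iwasawaH2Data_fineSelmerDual_embedding_loc.lengthAt_eq_of_eq_bot
    (h : exists_iwasawaH2Data_fineSelmerDual_embedding_loc) (hγ : κ.IsTopGenerator γ) (v : HeightOneSpectrum (𝓞 ℚ))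
    (hp : p ≠ 2) (hκ : κ.IsCyclotomic) (hv : ((Rat.HeightOneSpectrum.primesEquiv v : Nat.Primes) : ℕ) = p)
    (hbot : FixedPoints.addSubgroup ↥(κ.kerSubgroup ⊓ GreenbergSelmer.decomp v) (W.geomPrimaryTorsion p) = ⊥)
    (I : IwasawaH1Data W p κ γ) :
    ∃ J : IwasawaH2Data W p κ γ I, ∀ 𝔮 : PrimeSpectrum (IwasawaAlgebra p),
      lengthAt (IwasawaAlgebra p) J.H2 𝔮 = lengthAt (IwasawaAlgebra p) (W.fineSelmerDualData κ hγ).X 𝔮 := by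
  obtain ⟨J, ⟨f⟩⟩ := h.exists_linearEquiv_of_eq_bot hγ v hp hκ hv hbot I
  exact ⟨J, fun 𝔮 ↦ (lengthAt_eq_of_linearEquiv f 𝔮).symm⟩

end Corollaries

end Literature.NumberTheory.EllipticCurves.Kato2004

end
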